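import Mathlib
import HarnessLib
import Summits.Ventures.LatticeQCDFlow.Exactness.WilsonOverrelaxation

/-!
# An SU(2) staple sum is a non-negative multiple of an SU(2) matrix (quaternion algebra)

HONEST FRAMING: exact (Metropolis-corrected) sampling algorithms for lattice gauge theory;
figures of merit are autocorrelation/cost numbers at stated couplings and volumes; no
continuum-physics claim.

Venture `LatticeQCDFlow` (cell pub-lqcd), topic `Exactness`, FANOUT row 9 (eng-latcore, the
engine `latflow.core`: the SU(2) kernels `csrc/latcore_template.c` — heat bath, over-relaxation and
the Cabibbo–Marinari subgroup hits all start by writing the staple sum as `k ŝ`).  NEW WORK of the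
cell (2 × 2 matrix algebra over Mathlib); nothing is cited as a fact.  Printed counterparts, named
only: Creutz 1980 §III, Kennedy–Pendleton 1985, Cabibbo–Marinari 1982.

`WilsonOverrelaxation.lean` proves the over-relaxation reflection exact for the Wilson link action
PROVIDED the staple sum is `R = k • s` with `s sᴴ = 1`, and lists "that an SU(2) staple sum IS `k ŝ`
with `ŝ ∈ SU(2)` (quaternion algebra)" as not typed.  It is typed here.

## Content (`2 × 2` complex matrices; `conj` = complex conjugation)

* `IsQuat M` — `M` is a real quaternion `[[a, b], [-b̄, ā]]`: `M 1 1 = conj (M 0 0)` and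
  `M 1 0 = -conj (M 0 1)`.  Closure: `IsQuat.zero/one/add/sum/mul/conjTranspose/smul_real`, hence
  `IsQuat.staple` — every sum of products `U V Wᴴ` of quaternions (a staple sum) is a quaternion.
* `IsQuat.of_mem_specialUnitaryGroup` — every SU(2) matrix is a (unit) quaternion
  (`Mᴴ = M⁻¹ = adj M` read entrywise).
* `IsQuat.mul_conjTranspose_self` — `M Mᴴ = (|a|² + |b|²) • 1`; `IsQuat.det_eq` — `det M = |a|² + |b|²`
  (as a complex number), so `det M` is real and non-negative and vanishes only for `M = 0`
  (`IsQuat.normSq_pos`).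
* **`IsQuat.exists_eq_smul_specialUnitary`** — every quaternion `R` is `k • s` with `0 ≤ k`
  (`k = √(|a|² + |b|²) = √det R`) and `s ∈ SU(2)` (`k > 0` and `s = k⁻¹ R` when `R ≠ 0`; `k = 0`,
  `s = 1` when `R = 0`).
* **`IsQuat.wilsonLink_reflect`** — consequently the one-link Wilson action with ANY quaternionic
  staple sum `R` (in particular any SU(2) staple sum, `IsQuat.staple`) is conserved by the
  over-relaxation reflection `g ↦ s gᴴ s` through its unit part `s`: the hypothesis of
  `WilsonOverrelaxation.wilsonLink_reflect` discharged for `N = 2`.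

Not here: `N ≥ 3` (there the staple sum is not a multiple of a unitary; Cabibbo–Marinari applies the
`N = 2` statement inside each SU(2) subgroup), the heat-bath density in the `k ŝ` frame (Haar
marginal of `a₀`).
-/

namespace Summit.Ventures.LatticeQCDFlow.Exactness

open Matrix ComplexConjugate

/-- `M` is a real quaternion `[[a, b], [-b̄, ā]]` (`a = M 0 0`, `b = M 0 1`). -/
structure IsQuat (M : Matrix (Fin 2) (Fin 2) ℂ) : Prop where
  /-- the diagonal entries are complex conjugates -/
  diag : M 1 1 = conj (M 0 0)
  /-- the off-diagonal entries are minus complex conjugates -/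
  offdiag : M 1 0 = -conj (M 0 1)

namespace IsQuat

variable {A B M R : Matrix (Fin 2) (Fin 2) ℂ}

/-- `0` is a quaternion. -/
theorem zero : IsQuat 0 := ⟨by simp, by simp⟩

/-- `1` is a quaternion. -/
theorem one : IsQuat 1 := ⟨by simp, by simp⟩

/-- Quaternions are closed under addition. -/
theorem add (hA : IsQuat A) (hB : IsQuat B) : IsQuat (A + B) :=
  ⟨by rw [Matrix.add_apply, Matrix.add_apply, hA.1, hB.1, map_add],
   by rw [Matrix.add_apply, Matrix.add_apply, hA.2, hB.2, map_add, neg_add]⟩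

/-- … under finite sums. -/
theorem sum {ι : Type*} (s : Finset ι) {F : ι → Matrix (Fin 2) (Fin 2) ℂ} (h : ∀ i ∈ s, IsQuat (F i)) :
    IsQuat (∑ i ∈ s, F i) :=
  Finset.sum_induction F IsQuat (fun _ _ => add) zero h

/-- … under multiplication. -/
theorem mul (hA : IsQuat A) (hB : IsQuat B) : IsQuat (A * B) := by
  constructor
  · simp only [mul_apply, Fin.sum_univ_two, hA.1, hA.2, hB.1, hB.2, map_add, map_mul, map_neg, Complex.conj_conj]
    ring
  · simp only [mul_apply, Fin.sum_univ_two, hA.1, hA.2, hB.1, hB.2, map_add, map_mul, Complex.conj_conj]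
    ring

/-- … under the conjugate transpose. -/
theorem conjTranspose (hA : IsQuat A) : IsQuat Aᴴ := by
  constructor
  · simp only [conjTranspose_apply, Complex.star_def, hA.1, Complex.conj_conj]
  · simp only [conjTranspose_apply, Complex.star_def, hA.2, map_neg, Complex.conj_conj, neg_neg]

/-- … under real scalars. -/
theorem smul_real (hA : IsQuat A) (r : ℝ) : IsQuat ((r : ℂ) • A) :=
  ⟨by rw [Matrix.smul_apply, Matrix.smul_apply, hA.1, smul_eq_mul, smul_eq_mul, map_mul, Complex.conj_ofReal],
   by rw [Matrix.smul_apply, Matrix.smul_apply, hA.2, smul_eq_mul, smul_eq_mul, map_mul, Complex.conj_ofReal, mul_neg]⟩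

/-- **A staple sum of quaternions is a quaternion**: `∑ᵢ Uᵢ Vᵢ Wᵢᴴ`. -/
theorem staple {ι : Type*} (s : Finset ι) {U V W : ι → Matrix (Fin 2) (Fin 2) ℂ}
    (hU : ∀ i ∈ s, IsQuat (U i)) (hV : ∀ i ∈ s, IsQuat (V i)) (hW : ∀ i ∈ s, IsQuat (W i)) :
    IsQuat (∑ i ∈ s, U i * V i * (W i)ᴴ) :=
  sum s fun i hi => ((hU i hi).mul (hV i hi)).mul (hW i hi).conjTranspose

/-- **Every SU(2) matrix is a quaternion** (`Mᴴ = M⁻¹ = adj M`, read entrywise). -/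
theorem of_mem_specialUnitaryGroup (hM : M ∈ Matrix.specialUnitaryGroup (Fin 2) ℂ) : IsQuat M := by
  obtain ⟨hU, hdet⟩ := Matrix.mem_specialUnitaryGroup_iff.mp hM
  have hstar : star M = M.adjugate := by
    have h1 : M * star M = 1 := Matrix.mem_unitaryGroup_iff.mp hU
    rw [← Matrix.inv_eq_right_inv h1, Matrix.inv_def, hdet, Ring.inverse_one, one_smul]
  rw [Matrix.adjugate_fin_two, Matrix.star_eq_conjTranspose] at hstar
  have h00 := congrFun (congrFun hstar 0) 0
  have h10 := congrFun (congrFun hstar 1) 0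
  simp only [conjTranspose_apply, Complex.star_def, of_apply, cons_val', cons_val_zero, cons_val_one,
    empty_val', cons_val_fin_one] at h00 h10
  exact ⟨h00.symm, by rw [h10, neg_neg]⟩

/-- The squared norm `|a|² + |b|²` of a quaternion. -/
noncomputable def normSq (M : Matrix (Fin 2) (Fin 2) ℂ) : ℝ := Complex.normSq (M 0 0) + Complex.normSq (M 0 1)

/-- The squared norm is non-negative. -/
theorem normSq_nonneg (M : Matrix (Fin 2) (Fin 2) ℂ) : 0 ≤ normSq M :=
  add_nonneg (Complex.normSq_nonneg _) (Complex.normSq_nonneg _)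

/-- A non-zero quaternion has positive squared norm (its first row cannot vanish). -/
theorem normSq_pos (hR : IsQuat R) (h0 : R ≠ 0) : 0 < normSq R := by
  rcases (normSq_nonneg R).lt_or_eq with h | h
  · exact h
  exfalso
  have hz := (add_eq_zero_iff_of_nonneg (Complex.normSq_nonneg (R 0 0)) (Complex.normSq_nonneg (R 0 1))).mp h.symm
  have ha : R 0 0 = 0 := Complex.normSq_eq_zero.mp hz.1
  have hb : R 0 1 = 0 := Complex.normSq_eq_zero.mp hz.2
  apply h0
  ext i j
  fin_cases i <;> fin_cases j
  · exact ha
  · exact hb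
  · simp [hR.2, hb]
  · simp [hR.1, ha]

/-- `M Mᴴ = (|a|² + |b|²) • 1` for a quaternion. -/
theorem mul_conjTranspose_self (hM : IsQuat M) : M * Mᴴ = ((normSq M : ℝ) : ℂ) • (1 : Matrix (Fin 2) (Fin 2) ℂ) := by
  ext i j
  fin_cases i <;> fin_cases j <;>
    simp [mul_apply, Fin.sum_univ_two, conjTranspose_apply, hM.1, hM.2, normSq, Complex.mul_conj,
      Complex.normSq_eq_conj_mul_self] <;> ring

/-- `det M = |a|² + |b|²` for a quaternion. -/
theorem det_eq (hM : IsQuat M) : M.det = ((normSq M : ℝ) : ℂ) := by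
  rw [Matrix.det_fin_two, hM.1, hM.2, normSq, Complex.ofReal_add, ← Complex.mul_conj, ← Complex.mul_conj]
  ring

/-- **Polar form.**  Every quaternion is `k • s` with `0 ≤ k` (`k = √(|a|² + |b|²) = √det`) and
`s ∈ SU(2)`; `k > 0` unless the quaternion is zero. -/
theorem exists_eq_smul_specialUnitary (hR : IsQuat R) :
    ∃ k : ℝ, 0 ≤ k ∧ ∃ s : Matrix (Fin 2) (Fin 2) ℂ, s ∈ Matrix.specialUnitaryGroup (Fin 2) ℂ ∧ R = (k : ℂ) • s := by
  by_cases h0 : R = 0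
  · exact ⟨0, le_rfl, 1, Submonoid.one_mem _, by rw [h0, Complex.ofReal_zero, zero_smul]⟩
  have hq : 0 < normSq R := hR.normSq_pos h0
  set k : ℝ := Real.sqrt (normSq R) with hk
  have hk0 : 0 < k := Real.sqrt_pos.mpr hq
  have hkk : (k : ℂ) * k = (normSq R : ℝ) := by
    rw [← Complex.ofReal_mul, Real.mul_self_sqrt hq.le]
  have hkne : (k : ℂ) ≠ 0 := Complex.ofReal_ne_zero.mpr hk0.ne'
  refine ⟨k, hk0.le, (k : ℂ)⁻¹ • R, ?_, ?_⟩
  · rw [Matrix.mem_specialUnitaryGroup_iff, Matrix.mem_unitaryGroup_iff, Matrix.star_eq_conjTranspose]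
    constructor
    · rw [conjTranspose_smul, Matrix.smul_mul, Matrix.mul_smul, hR.mul_conjTranspose_self, smul_smul, smul_smul,
        Complex.star_def, Complex.conj_inv, Complex.conj_ofReal, ← hkk]
      convert one_smul ℂ (1 : Matrix (Fin 2) (Fin 2) ℂ) using 2
      field_simp
    · rw [Matrix.det_smul, hR.det_eq, Fintype.card_fin, ← hkk]
      field_simp
  · rw [smul_smul, mul_inv_cancel₀ hkne, one_smul]

/-- **The Wilson one-link action with a quaternionic staple sum is conserved by over-relaxation.**
For every quaternion `R` (e.g. any SU(2) staple sum, `IsQuat.staple`) there is `s ∈ SU(2)` with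
`R = √det R • s`, and for every real `c` and EVERY matrix `g`:
`wilsonLink c R (s gᴴ s) = wilsonLink c R g` — the `N = 2` hypothesis of `wilsonLink_reflect`. -/
theorem wilsonLink_reflect (hR : IsQuat R) (c : ℝ) :
    ∃ s : Matrix (Fin 2) (Fin 2) ℂ, s ∈ Matrix.specialUnitaryGroup (Fin 2) ℂ ∧
      ∀ g : Matrix (Fin 2) (Fin 2) ℂ, wilsonLink c R (s * gᴴ * s) = wilsonLink c R g := by
  obtain ⟨k, -, s, hs, rfl⟩ := hR.exists_eq_smul_specialUnitary
  refine ⟨s, hs, fun g => ?_⟩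
  have hss : s * sᴴ = 1 := by
    rw [← Matrix.star_eq_conjTranspose]
    exact Matrix.mem_unitaryGroup_iff.mp (Matrix.mem_specialUnitaryGroup_iff.mp hs).1
  exact Summit.Ventures.LatticeQCDFlow.Exactness.wilsonLink_reflect c k s g hss

end IsQuat

end Summit.Ventures.LatticeQCDFlow.Exactness
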